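import Literature.AlgebraicGeometry.HodgeTheory.BettiHodgeConjectureProductsTwoTopDegreeHomConditions
import Literature.AlgebraicGeometry.HodgeTheory.BettiHodgeConjectureProductsOffMiddleAlgebraicFactor
import Literature.AlgebraicGeometry.HodgeTheory.BettiHodgeConjectureFourfoldProductsHodgeNumbers
import HarnessLib

/-!
# `HC(Y × Z)` for an EVEN-dimensional smooth hypersurface `Y ⊂ ℙ^{2h+1}` with `HC(Y)` times ANY smooth projective `Z` with `HC(Z)`, from ONE count
# `dim_ℚ Hom_HS(H^{2h}(Y), H^{2ν}(Z)(ν − h)) ≤ ρ_h(Y) ρ_ν(Z)`; cubic fourfolds times anything; ODD-dimensional hypersurfaces times anything from ONE vanishing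
# `Hom_HS(H^{2h+1}(Y), H^{nₒ}(Z)(s)) = 0`; threefolds with `h^{2,0} = 0` / surfaces with `p_g = 0` (any `q`) times anything likewise
# (Voisin II Cor. 1.24–1.25; Voisin I §11.3.3 Thm. 11.38–11.40, Lemma 11.41, p. 287; Zucker 1977 (3.2); Murre 1977; Deligne 2000 §1)

Family `hodge`, lane `lit-hodgefound` (Track 2 foundations library; Layers A1/A4), layer `Literature/AlgebraicGeometry/HodgeTheory`.  THEOREMS ONLY (no definition, no named fact,
no instance, no notation; D-0026 net debt `0`).  Prover seat `lit-hodgefound-p21` (generation 39, row g39-#8), sequel of the seat's g39-#5/#6 `BettiHodgeConjectureProductsTwoTopDegreeHomConditions`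
(§5 there: a factor WITHOUT cohomology in its top odd degree makes the odd condition void, leaving `HC(Y × Z)` ⟸ `HC(Y)`, `HC(Z)` and the one top even count), the tree's
`BettiHodgeConjectureProductsOffMiddleAlgebraicFactor` (`IsSmoothHypersurface.finrank_bettiCohomology_eq_zero_of_odd`: `b_k(Y) = 0` for odd `k ≠ dim Y`, Cor. 1.24/1.25) and
`BettiHodgeConjectureFourfoldProductsHodgeNumbers` (`hodgeConjectureFor_cubicFourfold_holds`, Zucker/Murre; cubic fourfolds times curves / surfaces with `p_g = 0` / threefolds with `h^{2,0} = 0`).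
The tree's `BettiHodgeConjectureProductsMiddlePieceHomBound` §3 treats PAIRS of even-dimensional hypersurfaces; here the second factor is arbitrary.

THE MATHEMATICS.  A smooth hypersurface `Y ⊂ ℙ^{2h+1}_ℂ` (`h ≥ 1`) has no odd rational cohomology (Lefschetz hyperplane theorem and Poincaré duality, Cor. 1.24/1.25), in particular
`b_{2h−1}(Y) = 0` in its top odd degree `2h − 1 ≤ dim Y = 2h`.  By g39-#6, for any smooth projective `Z` of dimension `n ≥ 1` with top even degree `2ν` (`2ν ≤ n ≤ 2ν + 1`):
**`HC(Y)`, `HC(Z)` and `dim_ℚ Hom_HS(H^{2h}(Y), H^{2ν}(Z)(ν − h)) ≤ ρ_h(Y) ρ_ν(Z)` imply `HC(Y × Z)`** — the count says that the middle cohomology of `Y` and the top even cohomology of `Z` are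
related by no more morphisms of Hodge structures than the products of Hodge classes account for (no exceptional classes; by g39-#7 it is equivalent to their absence on all of `Y × Z`).  For a smooth
CUBIC FOURFOLD `X ⊂ ℙ⁵` (`HC(X)`: Zucker, Murre; `ρ₂(X) = dim Hdg²(H⁴X)`): **`HC(X × Z)` ⟸ `HC(Z)` and `dim Hom_HS(H⁴(X), H^{2ν}(Z)(ν − 2)) ≤ ρ₂(X) ρ_ν(Z)`**; e.g. `X × F` for a fourfold `F` with
`HC(F)` and `dim Hom_HS(H⁴X, H⁴F) ≤ ρ₂(X)ρ₂(F)`, `X × T` for a threefold `T` with `dim Hom_HS(H⁴X, H²T(−1)) ≤ ρ₂(X)ρ(T)`, `X × S` for a surface `S` with `dim Hom_HS(H⁴X, H²S(−1)) ≤ ρ₂(X)ρ(S)`.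
§2, the mirror image: a smooth hypersurface `Y` of ODD dimension `2h + 1` has `HC(Y)` and `H^{2h}(Y) = ℚ η^h` of pure type, so the EVEN count is automatic (a morphism of Hodge structures out of a
pure `(μ, μ)` structure is a linear map into the Hodge classes: `dim Hom_HS(H^{2μ}Y, H^{2ν}Z(ν − μ)) = ρ_μ(Y)ρ_ν(Z)` whenever `Hdg^μ(H^{2μ}Y) = H^{2μ}(Y;ℚ)`) and **`HC(Y × Z)` ⟸ `HC(Z)` and the ONE
vanishing `Hom_HS(H^{2h+1}(Y), H^{nₒ}(Z)((nₒ − 2h − 1)/2)) = 0`** for ANY `Z` (the tree's `IsSmoothHypersurface.hodgeConjectureFor_tensor_of_odd` is the case `b_{odd}(Z) = 0`); e.g. a smooth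
threefold `Y ⊂ ℙ⁴` times any threefold `T` with `Hom_HS(H³Y, H³T) = 0`, any fourfold `F` with `HC(F)` and `Hom_HS(H³Y, H³F) = 0`, any surface `S` with `Hom_HS(H³Y, H¹S(−1)) = 0`.
§3, the same for a THREEFOLD `T` with `h^{2,0}(T) = 0` or a SURFACE `S` with `p_g(S) = 0` (any irregularity; `H²` of pure type `(1,1)`): **`HC(T × Z)` ⟸ `HC(Z)`, `Hom_HS(H³T, H^{nₒ}Z(s)) = 0`**;
**`HC(S × Z)` ⟸ `HC(Z)`, `Hom_HS(H¹S, H^{nₒ}Z(s)) = 0`** (the lane's `…QZeroH20Zero…` / regular-surface criteria assume `q = 0`).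

THE PRINTS.  C. Voisin (2003) [VoisinHodgeII2003] §1.2.2 Thm. 1.23, §1.2.3 Cor. 1.24–1.25; §9.2.4 Prop. 9.20.  C. Voisin (2002) [VoisinHodgeI2002] §6.2.3 Cor. 6.26, Rem. 6.27; §7.3.1 Lemma 7.23;
§11.3.3 Thm. 11.38–11.40, Lemma 11.41, p. 287; §11.3.1 Thm. 11.30.  S. Zucker (1977) [Zucker1977] (3.2) Theorem.  J. Murre (1977) [Murre1977] Theorem and Corollary.  P. Deligne (2000)
[Deligne2000] §1.  No new mathematics is claimed (instances of g39-#5/#6).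

## References
* [VoisinHodgeII2003] C. Voisin, *Hodge Theory and Complex Algebraic Geometry II* (2003) — §1.2.2 Thm. 1.23, §1.2.3 Cor. 1.24–1.25, §9.2.4 Prop. 9.20.
* [VoisinHodgeI2002] C. Voisin, *Hodge Theory and Complex Algebraic Geometry I* (2002) — §6.2.3 Cor. 6.26, Rem. 6.27; §7.3.1 Lemma 7.23; §11.3.3 Thm. 11.38–11.40, Lemma 11.41, p. 287.
* [Zucker1977] S. Zucker, *The Hodge conjecture for cubic fourfolds*, Compositio Math. 34 (1977) — (3.2) Theorem.
* [Murre1977] J. P. Murre, *On the Hodge conjecture for unirational fourfolds*, Indag. Math. 39 (1977) — Theorem, Corollary.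
* [Deligne2000] P. Deligne, *The Hodge conjecture* (Clay, 2000) — §1.

## Provenance
Lane `lit-hodgefound` (Hodge path, Track 2), prover seat `lit-hodgefound-p21` (generation 39), self-proposed row g39-#8 (instances of g39-#5/#6).
-/

noncomputable section

open scoped TensorProduct
open CategoryTheory MonoidalCategory Module Finset
open Literature.AlgebraicTopology.SingularHomology
open Literature.Geometry.Kaehler

namespace Literature.AlgebraicGeometry.Motives.IsSmoothHypersurface

open Literature.AlgebraicGeometry.Motives
open Literature.AlgebraicGeometry.Motives.HodgeStructure
open Literature.AlgebraicGeometry.HodgeTheory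

variable {m n e : ℕ} {X Y Z T S F : SchemeOver ℂ}

/-- **AN EVEN-DIMENSIONAL SMOOTH HYPERSURFACE TIMES ANYTHING.**  Let `Y ⊂ ℙ^{2h+1}_ℂ` be a smooth hypersurface (`h ≥ 1`) with `HC(Y)`, and `Z` smooth projective of dimension `n ≥ 1` with `HC(Z)`
and top even degree `2ν ≤ n ≤ 2ν + 1`.  If **`dim_ℚ Hom_HS(H^{2h}(Y), H^{2ν}(Z)(s')) ≤ ρ_h(Y) ρ_ν(Z)`** (`2ν − 2s' = 2h`), then `HC(Y × Z)`: `b_{2h−1}(Y) = 0` (Cor. 1.24/1.25), so the odd condition of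
the two-condition criterion is void. [cite: VoisinHodgeII2003, §1.2.2 Thm. 1.23, §1.2.3 Cor. 1.24–1.25 and §9.2.4 Prop. 9.20] [cite: VoisinHodgeI2002, §6.2.3 Cor. 6.26, Rem. 6.27, §11.3.3 Thm. 11.38–11.40,
Lemma 11.41, p. 287] [cite: Deligne2000, §1] -/
theorem hodgeConjectureFor_tensor_of_even_dim_of_finrank_hom_hodge_le (hY : IsSmoothHypersurface m e Y) (hHD : exists_isReal_hodgeModel) {h : ℕ} (hm : m = 2 * h) (hh : 1 ≤ h)
    (hHC : HodgeConjectureFor m Y) (hZ : IsSmoothProjective n Z) (hHCZ : HodgeConjectureFor n Z) (hn : 1 ≤ n) {ν : ℕ} (hν : 2 * ν ≤ n) (hnν : n ≤ 2 * ν + 1) {s' : ℤ}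
    (hs' : ((2 * ν : ℕ) : ℤ) - 2 * s' = m)
    (hle : Module.finrank ℚ (Hom (BettiUniverse.hodge hHD hY.1 m) (((BettiUniverse.hodge hHD hZ (2 * ν)).tateTwist s').cast hs')) ≤
      Module.finrank ℚ ↥((BettiUniverse.hodge hHD hY.1 m).hodgeClasses h) * Module.finrank ℚ ↥((BettiUniverse.hodge hHD hZ (2 * ν)).hodgeClasses ν)) :
    HodgeConjectureFor (m + n) (Y ⊗ Z) := by
  subst hm
  exact BettiUniverse.hodgeConjectureFor_tensor_of_finrank_top_odd_eq_zero_left_of_finrank_hom_hodge_even_le hHD hY.1 hZ (hY.1.tensor_holds hZ) hHC hHCZ (mₒ := 2 * h - 1)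
    ⟨h - 1, by omega⟩ (by omega) (by omega) (hY.finrank_bettiCohomology_eq_zero_of_odd ⟨h - 1, by omega⟩ (by omega)) hn (μ := h) le_rfl (by omega) hν hnν hs' hle

/-- **A CUBIC FOURFOLD TIMES ANYTHING.**  Let `X ⊂ ℙ⁵_ℂ` be a smooth cubic fourfold and `Z` smooth projective of dimension `n ≥ 1` with `HC(Z)`, top even degree `2ν ≤ n ≤ 2ν + 1`.  If
**`dim_ℚ Hom_HS(H⁴(X), H^{2ν}(Z)(s')) ≤ ρ₂(X) ρ_ν(Z)`** (`2ν − 2s' = 4`; `ρ₂(X) = dim Hdg²(H⁴X)`), then `HC(X × Z)` (`HC(X)`: Zucker, Murre). [cite: Zucker1977, (3.2) Theorem, p. 206] [cite: Murre1977, Theorem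
and Corollary, p. 230] [cite: VoisinHodgeII2003, §1.2.3 Cor. 1.24–1.25] [cite: VoisinHodgeI2002, §11.3.3 Thm. 11.38–11.40, Lemma 11.41, p. 287] [cite: Deligne2000, §1] -/
theorem hodgeConjectureFor_cubicFourfold_tensor_of_finrank_hom_hodge_le (hX : IsSmoothHypersurface 4 3 X) (hHD : exists_isReal_hodgeModel) (hZ : IsSmoothProjective n Z)
    (hHCZ : HodgeConjectureFor n Z) (hn : 1 ≤ n) {ν : ℕ} (hν : 2 * ν ≤ n) (hnν : n ≤ 2 * ν + 1) {s' : ℤ} (hs' : ((2 * ν : ℕ) : ℤ) - 2 * s' = ((4 : ℕ) : ℤ))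
    (hle : Module.finrank ℚ (Hom (BettiUniverse.hodge hHD hX.1 4) (((BettiUniverse.hodge hHD hZ (2 * ν)).tateTwist s').cast hs')) ≤
      Module.finrank ℚ ↥((BettiUniverse.hodge hHD hX.1 4).hodgeClasses 2) * Module.finrank ℚ ↥((BettiUniverse.hodge hHD hZ (2 * ν)).hodgeClasses ν)) :
    HodgeConjectureFor (4 + n) (X ⊗ Z) :=
  hX.hodgeConjectureFor_tensor_of_even_dim_of_finrank_hom_hodge_le hHD (h := 2) rfl (by norm_num) (hodgeConjectureFor_cubicFourfold_holds hX) hZ hHCZ hn hν hnν hs' hle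

/-- **A cubic fourfold times a fourfold**: `HC(X × F)` ⟸ `HC(F)` and `dim_ℚ Hom_HS(H⁴(X), H⁴(F)) ≤ ρ₂(X) ρ₂(F)`. [cite: Zucker1977, (3.2) Theorem, p. 206] [cite: Murre1977, Theorem and Corollary, p. 230]
[cite: VoisinHodgeII2003, §1.2.3 Cor. 1.24–1.25] [cite: VoisinHodgeI2002, §11.3.3 Thm. 11.38–11.40, Lemma 11.41, p. 287] [cite: Deligne2000, §1] -/
theorem hodgeConjectureFor_cubicFourfold_tensor_fourfold_of_finrank_hom_le (hX : IsSmoothHypersurface 4 3 X) (hHD : exists_isReal_hodgeModel) (hF : IsSmoothProjective 4 F)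
    (hHCF : HodgeConjectureFor 4 F)
    (hle : Module.finrank ℚ (Hom (BettiUniverse.hodge hHD hX.1 4) (BettiUniverse.hodge hHD hF 4)) ≤
      Module.finrank ℚ ↥((BettiUniverse.hodge hHD hX.1 4).hodgeClasses 2) * Module.finrank ℚ ↥((BettiUniverse.hodge hHD hF 4).hodgeClasses 2)) :
    HodgeConjectureFor (4 + 4) (X ⊗ F) :=
  hX.hodgeConjectureFor_cubicFourfold_tensor_of_finrank_hom_hodge_le hHD hF hHCF (by norm_num) (ν := 2) (by norm_num) (by norm_num) (s' := 0) (by norm_num)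
    ((finrank_hom_twistCast_zero_right _ _ _).trans_le hle)

/-- **A cubic fourfold times a threefold**: `HC(X × T)` ⟸ `dim_ℚ Hom_HS(H⁴(X), H²(T)(−1)) ≤ ρ₂(X) ρ(T)` (`HC(T)` holds). [cite: Zucker1977, (3.2) Theorem, p. 206] [cite: Murre1977, Theorem and Corollary, p. 230]
[cite: VoisinHodgeII2003, §1.2.3 Cor. 1.24–1.25] [cite: VoisinHodgeI2002, §11.3.3 Thm. 11.38–11.40, Lemma 11.41, p. 287 and §11.3.1 Thm. 11.30] [cite: Deligne2000, §1] -/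
theorem hodgeConjectureFor_cubicFourfold_tensor_threefold_of_finrank_hom_le (hX : IsSmoothHypersurface 4 3 X) (hHD : exists_isReal_hodgeModel) (hT : IsSmoothProjective 3 T)
    (hle : Module.finrank ℚ (Hom (BettiUniverse.hodge hHD hX.1 4) (((BettiUniverse.hodge hHD hT 2).tateTwist (-1)).cast (by norm_num))) ≤
      Module.finrank ℚ ↥((BettiUniverse.hodge hHD hX.1 4).hodgeClasses 2) * Module.finrank ℚ ↥((BettiUniverse.hodge hHD hT 2).hodgeClasses 1)) :
    HodgeConjectureFor (4 + 3) (X ⊗ T) :=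
  hX.hodgeConjectureFor_cubicFourfold_tensor_of_finrank_hom_hodge_le hHD hT (hodgeConjectureFor_of_dim_le_three_holds le_rfl hT) (by norm_num) (ν := 1) (by norm_num) (by norm_num)
    (s' := -1) (by norm_num) hle

/-- **A cubic fourfold times a surface**: `HC(X × S)` ⟸ `dim_ℚ Hom_HS(H⁴(X), H²(S)(−1)) ≤ ρ₂(X) ρ(S)` (`HC(S)` holds; for `p_g(S) = 0` the count is automatic, cf. the tree's
`hodgeConjectureFor_cubicFourfold_tensor_surface_of_pg_zero`). [cite: Zucker1977, (3.2) Theorem, p. 206] [cite: Murre1977, Theorem and Corollary, p. 230] [cite: VoisinHodgeII2003, §1.2.3 Cor. 1.24–1.25]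
[cite: VoisinHodgeI2002, §11.3.3 Thm. 11.38–11.40, Lemma 11.41, p. 287 and §11.3.1 Thm. 11.30] [cite: Deligne2000, §1] -/
theorem hodgeConjectureFor_cubicFourfold_tensor_surface_of_finrank_hom_le (hX : IsSmoothHypersurface 4 3 X) (hHD : exists_isReal_hodgeModel) (hS : IsSmoothProjective 2 S)
    (hle : Module.finrank ℚ (Hom (BettiUniverse.hodge hHD hX.1 4) (((BettiUniverse.hodge hHD hS 2).tateTwist (-1)).cast (by norm_num))) ≤
      Module.finrank ℚ ↥((BettiUniverse.hodge hHD hX.1 4).hodgeClasses 2) * Module.finrank ℚ ↥((BettiUniverse.hodge hHD hS 2).hodgeClasses 1)) :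
    HodgeConjectureFor (4 + 2) (X ⊗ S) :=
  hX.hodgeConjectureFor_cubicFourfold_tensor_of_finrank_hom_hodge_le hHD hS (hodgeConjectureFor_of_dim_le_three_holds (by norm_num) hS) (by norm_num) (ν := 1) (by norm_num)
    (by norm_num) (s' := -1) (by norm_num) hle

end Literature.AlgebraicGeometry.Motives.IsSmoothHypersurface

/-! ### §2 A factor whose top even cohomology consists of Hodge classes; ODD-dimensional hypersurfaces times anything -/

namespace Literature.AlgebraicGeometry.HodgeTheory

open Literature.AlgebraicGeometry.Motives
open Literature.AlgebraicGeometry.Motives.HodgeStructure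

variable {m n : ℕ} {Y Z : SchemeOver ℂ}

/-- **If `H^{2μ}(Y)` consists of Hodge classes, the even count is an equality: `dim_ℚ Hom_HS(H^{2μ}(Y), H^{2ν}(Z)(s')) = ρ_μ(Y) ρ_ν(Z)`** (`2ν − 2s' = 2μ`): a morphism of Hodge structures
out of a pure `(μ, μ)` structure is a linear map into the Hodge classes (Lemma 11.41 + Thm. 11.38: `Hdg(H^{2μ}Y ⊗ H^{2ν}Z) = H^{2μ}(Y;ℚ) ⊗ Hdg^ν(H^{2ν}Z)`). [cite: VoisinHodgeI2002, §11.3.3 Thm. 11.38,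
Lemma 11.41 (p. 286) and p. 287] [cite: DeligneHodgeII1971, 2.1.13] [cite: HulekLaface2019PicardNumbersAV, §2.1 Prop. 2.2] -/
theorem BettiUniverse.finrank_hom_hodge_tateTwist_eq_mul_of_hodgeClasses_eq_top (hHD : exists_isReal_hodgeModel) (hY : IsSmoothProjective m Y) (hZ : IsSmoothProjective n Z)
    {μ ν : ℕ} (htop : (BettiUniverse.hodge hHD hY (2 * μ)).hodgeClasses μ = ⊤) {s' : ℤ} (hs' : ((2 * ν : ℕ) : ℤ) - 2 * s' = ((2 * μ : ℕ) : ℤ)) :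
    Module.finrank ℚ (Hom (BettiUniverse.hodge hHD hY (2 * μ)) (((BettiUniverse.hodge hHD hZ (2 * ν)).tateTwist s').cast hs')) =
      Module.finrank ℚ ↥((BettiUniverse.hodge hHD hY (2 * μ)).hodgeClasses μ) * Module.finrank ℚ ↥((BettiUniverse.hodge hHD hZ (2 * ν)).hodgeClasses ν) := by
  haveI : HodgeTensorFacts.{0, 0} := hodgeTensorFacts_holds
  haveI := BettiUniverse.finite hY (2 * μ)
  have e := BettiUniverse.finrank_hodgeClasses_tensor_hodge_eq_finrank_hom_tateTwist hHD hY hZ (2 * μ) (2 * ν) hs'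
  rw [show (((2 * μ : ℕ) : ℤ) + s') = (μ : ℤ) + ν by push_cast at hs' ⊢; omega] at e
  rw [← e, BettiUniverse.finrank_hodgeClasses_tensor_hodge_of_hodgeClasses_eq_top_left hHD hY hZ (i := 2 * μ) (a := (μ : ℤ)) (by push_cast; ring) htop (2 * ν) (ν : ℤ), htop,
    finrank_top]

/-- **A factor with `H^{2μ}(Y)` of pure type `(μ, μ)` in its top even degree: `HC(Y × Z)` ⟸ `HC(Y)`, `HC(Z)` and the ONE vanishing `Hom_HS(H^{mₒ}(Y), H^{nₒ}(Z)(s)) = 0`** (top odd degrees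
`mₒ ≤ m ≤ mₒ + 1`, `nₒ ≤ n ≤ nₒ + 1`, `nₒ − 2s = mₒ`; `2μ ≤ m ≤ 2μ + 1`): the even count of the two-condition criterion is automatic. [cite: VoisinHodgeI2002, §6.2.3 Cor. 6.26, Rem. 6.27, §7.3.1
Lemma 7.23, Lemma 7.26, §11.3.3 Thm. 11.38–11.40, Lemma 11.41, p. 287] [cite: VoisinHodgeII2003, §9.2.4 Prop. 9.20] [cite: DeligneHodgeII1971, 2.1.13] [cite: Deligne2000, §1] -/
theorem BettiUniverse.hodgeConjectureFor_tensor_of_subsingleton_hom_hodge_odd_of_hodgeClasses_even_eq_top (hHD : exists_isReal_hodgeModel) (hY : IsSmoothProjective m Y)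
    (hZ : IsSmoothProjective n Z) {d : ℕ} (hYZ : IsSmoothProjective d (Y ⊗ Z)) (hHCY : HodgeConjectureFor m Y) (hHCZ : HodgeConjectureFor n Z) {mₒ nₒ : ℕ} (hmₒ : Odd mₒ)
    (hmₒm : mₒ ≤ m) (hmmₒ : m ≤ mₒ + 1) (hnₒ : Odd nₒ) (hnₒn : nₒ ≤ n) (hnnₒ : n ≤ nₒ + 1) {s : ℤ} (hs : (nₒ : ℤ) - 2 * s = mₒ)
    (hodd : Subsingleton (Hom (BettiUniverse.hodge hHD hY mₒ) (((BettiUniverse.hodge hHD hZ nₒ).tateTwist s).cast hs))) {μ : ℕ} (hμ : 2 * μ ≤ m) (hmμ : m ≤ 2 * μ + 1)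
    (htop : (BettiUniverse.hodge hHD hY (2 * μ)).hodgeClasses μ = ⊤) : HodgeConjectureFor d (Y ⊗ Z) :=
  BettiUniverse.hodgeConjectureFor_tensor_of_subsingleton_hom_hodge_odd_of_finrank_hom_hodge_even_le hHD hY hZ hYZ hHCY hHCZ hmₒ hmₒm hmmₒ hnₒ hnₒn hnnₒ hs hodd hμ hmμ
    (ν := n / 2) (by omega) (by omega) (s' := ((n / 2 : ℕ) : ℤ) - μ) (by push_cast; ring)
    (BettiUniverse.finrank_hom_hodge_tateTwist_eq_mul_of_hodgeClasses_eq_top hHD hY hZ htop _).le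

end Literature.AlgebraicGeometry.HodgeTheory

namespace Literature.AlgebraicGeometry.Motives.IsSmoothHypersurface

open Literature.AlgebraicGeometry.Motives
open Literature.AlgebraicGeometry.Motives.HodgeStructure
open Literature.AlgebraicGeometry.HodgeTheory

variable {m n e : ℕ} {X Y Z T S F : SchemeOver ℂ}

/-- **AN ODD-DIMENSIONAL SMOOTH HYPERSURFACE TIMES ANYTHING.**  Let `Y ⊂ ℙ^{2h+2}_ℂ` be a smooth hypersurface of dimension `m = 2h + 1` and `Z` smooth projective of dimension `n` with `HC(Z)` and
top odd degree `nₒ ≤ n ≤ nₒ + 1`.  If **`Hom_HS(H^{2h+1}(Y), H^{nₒ}(Z)(s)) = 0`** (`nₒ − 2s = 2h + 1`), then `HC(Y × Z)`: `HC(Y)` holds and `H^{2h}(Y) = ℚ η^h` is of pure type (Cor. 1.24/1.25), so the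
even count is automatic and the odd condition is the only one (the tree's `hodgeConjectureFor_tensor_of_odd` is the case `b_{odd}(Z) = 0`). [cite: VoisinHodgeII2003, §1.2.2 Thm. 1.23, §1.2.3
Cor. 1.24–1.25 and §9.2.4 Prop. 9.20] [cite: VoisinHodgeI2002, §6.2.3 Cor. 6.26, Rem. 6.27, §11.3.3 Thm. 11.38–11.40, Lemma 11.41, p. 287] [cite: Deligne2000, §1] -/
theorem hodgeConjectureFor_tensor_of_odd_dim_of_subsingleton_hom (hY : IsSmoothHypersurface m e Y) (hHD : exists_isReal_hodgeModel) {h : ℕ} (hm : m = 2 * h + 1)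
    (hZ : IsSmoothProjective n Z) (hHCZ : HodgeConjectureFor n Z) {nₒ : ℕ} (hnₒ : Odd nₒ) (hnₒn : nₒ ≤ n) (hnnₒ : n ≤ nₒ + 1) {s : ℤ} (hs : (nₒ : ℤ) - 2 * s = m)
    (hodd : Subsingleton (Hom (BettiUniverse.hodge hHD hY.1 m) (((BettiUniverse.hodge hHD hZ nₒ).tateTwist s).cast hs))) : HodgeConjectureFor (m + n) (Y ⊗ Z) := by
  subst hm
  exact BettiUniverse.hodgeConjectureFor_tensor_of_subsingleton_hom_hodge_odd_of_hodgeClasses_even_eq_top hHD hY.1 hZ (hY.1.tensor_holds hZ) (hY.hodgeConjectureFor_of_odd hHD ⟨h, rfl⟩)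
    hHCZ ⟨h, rfl⟩ le_rfl (by omega) hnₒ hnₒn hnnₒ hs hodd (μ := h) (by omega) le_rfl (hY.hodgeClasses_hodge_eq_top_of_odd hHD hY.1 ⟨h, rfl⟩ h)

/-- **A smooth threefold hypersurface `Y ⊂ ℙ⁴` (e.g. a quintic threefold) times a fourfold `F`: `HC(Y × F)` ⟸ `HC(F)` and `Hom_HS(H³(Y), H³(F)) = 0`.** [cite: VoisinHodgeII2003, §1.2.3 Cor. 1.24–1.25]
[cite: VoisinHodgeI2002, §11.3.3 Thm. 11.38–11.40, Lemma 11.41, p. 287] [cite: Deligne2000, §1] -/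
theorem hodgeConjectureFor_threefold_tensor_fourfold_of_subsingleton_hom_three (hY : IsSmoothHypersurface 3 e Y) (hHD : exists_isReal_hodgeModel) (hF : IsSmoothProjective 4 F)
    (hHCF : HodgeConjectureFor 4 F) (h33 : Subsingleton (Hom (BettiUniverse.hodge hHD hY.1 3) (BettiUniverse.hodge hHD hF 3))) : HodgeConjectureFor (3 + 4) (Y ⊗ F) :=
  hY.hodgeConjectureFor_tensor_of_odd_dim_of_subsingleton_hom hHD (h := 1) rfl hF hHCF (nₒ := 3) (by decide) (by norm_num) (by norm_num) (s := 0) (by norm_num)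
    ((subsingleton_hom_twistCast_zero_right_iff _ _ _).2 h33)

/-- **A smooth threefold hypersurface `Y ⊂ ℙ⁴` times ANY smooth projective threefold `T`: `HC(Y × T)` ⟸ `Hom_HS(H³(Y), H³(T)) = 0`** (`HC(T)` holds; `h^{2,0}(Y) = 0`, cf. the lane's
`…threefolds_of_h20_zero_of_subsingleton_hom_three`). [cite: VoisinHodgeII2003, §1.2.3 Cor. 1.24–1.25] [cite: VoisinHodgeI2002, §11.3.3 Thm. 11.38–11.40, Lemma 11.41, p. 287 and §11.3.1 Thm. 11.30]
[cite: Deligne2000, §1] -/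
theorem hodgeConjectureFor_threefold_tensor_threefold_of_subsingleton_hom_three (hY : IsSmoothHypersurface 3 e Y) (hHD : exists_isReal_hodgeModel) (hT : IsSmoothProjective 3 T)
    (h33 : Subsingleton (Hom (BettiUniverse.hodge hHD hY.1 3) (BettiUniverse.hodge hHD hT 3))) : HodgeConjectureFor (3 + 3) (Y ⊗ T) :=
  hY.hodgeConjectureFor_tensor_of_odd_dim_of_subsingleton_hom hHD (h := 1) rfl hT (hodgeConjectureFor_of_dim_le_three_holds le_rfl hT) (nₒ := 3) (by decide) (by norm_num)
    (by norm_num) (s := 0) (by norm_num) ((subsingleton_hom_twistCast_zero_right_iff _ _ _).2 h33)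

/-- **A smooth threefold hypersurface `Y ⊂ ℙ⁴` times ANY smooth projective surface `S`: `HC(Y × S)` ⟸ `Hom_HS(H³(Y), H¹(S)(−1)) = 0`.** [cite: VoisinHodgeII2003, §1.2.3 Cor. 1.24–1.25]
[cite: VoisinHodgeI2002, §11.3.3 Thm. 11.38–11.40, Lemma 11.41, p. 287 and §11.3.1 Thm. 11.30] [cite: Deligne2000, §1] -/
theorem hodgeConjectureFor_threefold_tensor_surface_of_subsingleton_hom (hY : IsSmoothHypersurface 3 e Y) (hHD : exists_isReal_hodgeModel) (hS : IsSmoothProjective 2 S)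
    (h31 : Subsingleton (Hom (BettiUniverse.hodge hHD hY.1 3) (((BettiUniverse.hodge hHD hS 1).tateTwist (-1)).cast (by norm_num)))) : HodgeConjectureFor (3 + 2) (Y ⊗ S) :=
  hY.hodgeConjectureFor_tensor_of_odd_dim_of_subsingleton_hom hHD (h := 1) rfl hS (hodgeConjectureFor_of_dim_le_three_holds (by norm_num) hS) (nₒ := 1) (by decide) (by norm_num)
    (by norm_num) (s := -1) (by norm_num) h31

end Literature.AlgebraicGeometry.Motives.IsSmoothHypersurface

/-! ### §3 Surfaces with `p_g = 0` and threefolds with `h^{2,0} = 0` (any irregularity) times anything -/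

namespace Literature.AlgebraicGeometry.HodgeTheory

open Literature.AlgebraicGeometry.Motives
open Literature.AlgebraicGeometry.Motives.HodgeStructure

variable {n d : ℕ} {S T Z : SchemeOver ℂ}

/-- **A smooth projective THREEFOLD `T` with `h^{2,0}(T) = 0` (any `q(T)`) times ANY smooth projective `Z` with `HC(Z)`: `HC(T × Z)` ⟸ `Hom_HS(H³(T), H^{nₒ}(Z)(s)) = 0`** for the top odd degree
`nₒ ≤ n ≤ nₒ + 1` of `Z` (`nₒ − 2s = 3`): `H²(T)` is of pure type `(1,1)`, so the even count is automatic (§2), and `HC(T)` holds; the lane's `…ThreefoldQZeroH20ZeroTimesVariety…` criteria assume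
`q(T) = 0` as well. [cite: VoisinHodgeI2002, §6.2.3 Cor. 6.26, Rem. 6.27, §11.3.3 Thm. 11.38–11.40, Lemma 11.41, p. 287 and §11.3.1 Thm. 11.30] [cite: DeligneHodgeII1971, 2.1.13] [cite: Deligne2000, §1] -/
theorem BettiUniverse.hodgeConjectureFor_threefold_tensor_of_h20_zero_of_subsingleton_hom (hHD : exists_isReal_hodgeModel) (hT : IsSmoothProjective 3 T) (hZ : IsSmoothProjective n Z)
    (hTZ : IsSmoothProjective d (T ⊗ Z)) (hHCZ : HodgeConjectureFor n Z) (h20 : (BettiUniverse.hodge hHD hT 2).hodgeNumber 2 0 = 0) {nₒ : ℕ} (hnₒ : Odd nₒ) (hnₒn : nₒ ≤ n)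
    (hnnₒ : n ≤ nₒ + 1) {s : ℤ} (hs : (nₒ : ℤ) - 2 * s = ((3 : ℕ) : ℤ))
    (hodd : Subsingleton (Hom (BettiUniverse.hodge hHD hT 3) (((BettiUniverse.hodge hHD hZ nₒ).tateTwist s).cast hs))) : HodgeConjectureFor d (T ⊗ Z) :=
  BettiUniverse.hodgeConjectureFor_tensor_of_subsingleton_hom_hodge_odd_of_hodgeClasses_even_eq_top hHD hT hZ hTZ (hodgeConjectureFor_of_dim_le_three_holds le_rfl hT) hHCZ (mₒ := 3)
    (by decide) le_rfl (by norm_num) hnₒ hnₒn hnnₒ hs hodd (μ := 1) (by norm_num) (by norm_num) ((BettiUniverse.hodgeClasses_hodge_two_eq_top_iff hHD hT).2 h20)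

/-- **A smooth projective SURFACE `S` with `p_g(S) = 0` (any `q(S)`) times ANY smooth projective `Z` with `HC(Z)`: `HC(S × Z)` ⟸ `Hom_HS(H¹(S), H^{nₒ}(Z)(s)) = 0`** for the top odd degree `nₒ` of `Z`
(`nₒ − 2s = 1`): `H²(S)` is of pure type `(1,1)` (Lefschetz `(1,1)`: all of it algebraic). [cite: VoisinHodgeI2002, §6.2.3 Cor. 6.26, Rem. 6.27, §11.3.3 Thm. 11.38–11.40, Lemma 11.41, p. 287 and §11.3.1
Thm. 11.30] [cite: DeligneHodgeII1971, 2.1.13] [cite: Deligne2000, §1] -/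
theorem BettiUniverse.hodgeConjectureFor_surface_tensor_of_pg_zero_of_subsingleton_hom (hHD : exists_isReal_hodgeModel) (hS : IsSmoothProjective 2 S) (hZ : IsSmoothProjective n Z)
    (hSZ : IsSmoothProjective d (S ⊗ Z)) (hHCZ : HodgeConjectureFor n Z) (hpg : (BettiUniverse.hodge hHD hS 2).hodgeNumber 2 0 = 0) {nₒ : ℕ} (hnₒ : Odd nₒ) (hnₒn : nₒ ≤ n)
    (hnnₒ : n ≤ nₒ + 1) {s : ℤ} (hs : (nₒ : ℤ) - 2 * s = ((1 : ℕ) : ℤ))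
    (hodd : Subsingleton (Hom (BettiUniverse.hodge hHD hS 1) (((BettiUniverse.hodge hHD hZ nₒ).tateTwist s).cast hs))) : HodgeConjectureFor d (S ⊗ Z) :=
  BettiUniverse.hodgeConjectureFor_tensor_of_subsingleton_hom_hodge_odd_of_hodgeClasses_even_eq_top hHD hS hZ hSZ (hodgeConjectureFor_of_dim_le_three_holds (by norm_num) hS) hHCZ
    (mₒ := 1) (by decide) (by norm_num) (by norm_num) hnₒ hnₒn hnnₒ hs hodd (μ := 1) le_rfl (by norm_num) ((BettiUniverse.hodgeClasses_hodge_two_eq_top_iff hHD hS).2 hpg)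

/-- E.g. **a threefold `T` with `h^{2,0}(T) = 0` times a fourfold `F`: `HC(T × F)` ⟸ `HC(F)` and `Hom_HS(H³(T), H³(F)) = 0`.** [cite: VoisinHodgeI2002, §11.3.3 Thm. 11.38–11.40, Lemma 11.41, p. 287 and
§11.3.1 Thm. 11.30] [cite: Deligne2000, §1] -/
theorem BettiUniverse.hodgeConjectureFor_threefold_tensor_fourfold_of_h20_zero_of_subsingleton_hom_three (hHD : exists_isReal_hodgeModel) (hT : IsSmoothProjective 3 T)
    {F : SchemeOver ℂ} (hF : IsSmoothProjective 4 F) (hTF : IsSmoothProjective d (T ⊗ F)) (hHCF : HodgeConjectureFor 4 F) (h20 : (BettiUniverse.hodge hHD hT 2).hodgeNumber 2 0 = 0)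
    (h33 : Subsingleton (Hom (BettiUniverse.hodge hHD hT 3) (BettiUniverse.hodge hHD hF 3))) : HodgeConjectureFor d (T ⊗ F) :=
  BettiUniverse.hodgeConjectureFor_threefold_tensor_of_h20_zero_of_subsingleton_hom hHD hT hF hTF hHCF h20 (nₒ := 3) (by decide) (by norm_num) (by norm_num) (s := 0) (by norm_num)
    ((subsingleton_hom_twistCast_zero_right_iff _ _ _).2 h33)

/-- E.g. **a surface `S` with `p_g(S) = 0` times a fourfold `F`: `HC(S × F)` ⟸ `HC(F)` and `Hom_HS(H¹(S), H³(F)(1)) = 0`.** [cite: VoisinHodgeI2002, §11.3.3 Thm. 11.38–11.40, Lemma 11.41, p. 287 and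
§11.3.1 Thm. 11.30] [cite: Deligne2000, §1] -/
theorem BettiUniverse.hodgeConjectureFor_surface_tensor_fourfold_of_pg_zero_of_subsingleton_hom_one_three (hHD : exists_isReal_hodgeModel) (hS : IsSmoothProjective 2 S)
    {F : SchemeOver ℂ} (hF : IsSmoothProjective 4 F) (hSF : IsSmoothProjective d (S ⊗ F)) (hHCF : HodgeConjectureFor 4 F) (hpg : (BettiUniverse.hodge hHD hS 2).hodgeNumber 2 0 = 0)
    (h13 : Subsingleton (Hom (BettiUniverse.hodge hHD hS 1) (((BettiUniverse.hodge hHD hF 3).tateTwist 1).cast (by norm_num)))) : HodgeConjectureFor d (S ⊗ F) :=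
  BettiUniverse.hodgeConjectureFor_surface_tensor_of_pg_zero_of_subsingleton_hom hHD hS hF hSF hHCF hpg (nₒ := 3) (by decide) (by norm_num) (by norm_num) (s := 1) (by norm_num) h13

end Literature.AlgebraicGeometry.HodgeTheory

end
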